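import Summits.QuantumFields.QCD.Theorems.HeatSlicedQuarksRobustYangMillsHandoverFermionSliceSqrt
import Summits.QuantumFields.QCD.Theorems.HeatSlicedQuarksRobustYangMillsHandoverStubGammaConjDGamma
import HarnessLib

/-!
# Stub `stub_fermionSlice_sqrt_dGamma_conj` of line `pin-the-infimum` (crux `RobustYangMillsHandover`, 8892)

E2, layer δ2c of the fermionic-insertion bricks in Lüscher's transfer-matrix representation of the
QCD torus functional.  The spectral realisation of the transfer matrix uses Smit's SYMMETRIC splitting
`𝕋 = R T̂_U R` with `R(U) := T̂_F(U)^{1/2} = CFC.sqrt (fermionSliceOp U mq)`, the positive square root of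
Lüscher's fermionic one-step transfer operator (*Introduction to Quantum Fields on a Lattice*, §6.5
(6.87), (6.91)).  A quark-bilinear insertion `Q = dΓ(Y) + c·1` sitting in front of `T̂_F(U)` becomes
`R⁻¹ Q R` in the symmetric picture, and this file shows that it stays of the form
"`dΓ` of a ONE-particle matrix plus a constant":

* `T̂_F(U) = (det A)² • Γ(M_F)` by definition (`fermionSliceOp`, `fockLift = Gamma`), with
  `A = sliceMassHop U mq` positive definite (`sliceMassHop_posDef`), so `det A = r` is a positive real,
  and `M_F = fermionSliceMatrix U mq` positive definite (`fermionSliceMatrix_posDef`), with positive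
  square root `Rh := (reindex M_F)^{1/2}` (`IsStrictlyPositive.sqrt`, `CFC.sqrt_mul_sqrt_self`);
* `Γ(Rh)` is positive definite (`fockLift_posDef`) and `Γ(Rh)² = Γ(Rh²) = Γ(M_F)` (functoriality
  `Gamma_mul`), so `b := r • Γ(Rh) ≥ 0` squares to `T̂_F(U)`; by UNIQUENESS of the non-negative square
  root in the C⋆-algebra `Matrix _ _ ℂ` (`CFC.sqrt_unique`) `R(U) = r • Γ(Rh)`;
* hence `R⁻¹ dΓ(Y) R = Γ(Rh)⁻¹ dΓ(Y) Γ(Rh) = Γ(Rh⁻¹) dΓ(Y) Γ(Rh) = dΓ(Rh⁻¹ Y Rh)` by the covariance of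
  `dΓ` under `Γ` of an invertible one-particle matrix (landed `stub_Gamma_conj_dGamma`,
  Dereziński–Gérard Prop. 3.23 (1)); the scalar `r` cancels, and constants are untouched.

References: M. Lüscher, Commun. Math. Phys. 54 (1977) 283, §3 [Luscher1977]; J. Smit, *Introduction
to Quantum Fields on a Lattice*, §6.5 (6.87), (6.91) [Smit2023]; J. Dereziński, C. Gérard,
*Mathematics of Quantization and Quantum Fields*, Prop. 3.23.  Pure theorem file (no definitions);
the generic lemmas live in the sub-namespace `StubFermionSliceSqrtDGammaConj`.
-/

noncomputable section

namespace Summit.QuantumFields.QCD.Cruxes.RobustYangMillsHandover.PinTheInfimum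

open Matrix Literature.MathematicalPhysics.QuantumFieldTheory
  Literature.MathematicalPhysics.QuantumLattice
open Summit.QuantumFields.QCD.Cruxes.StableActionBridge.Sketch
open scoped ComplexOrder MatrixOrder

namespace StubFermionSliceSqrtDGammaConj

/-- A complex number which is positive in the star order of `ℂ` is a positive real:
`0 < z ⇒ z = z.re` with `0 < z.re`. [folklore] -/
theorem eq_ofReal_re_of_pos {z : ℂ} (hz : 0 < z) : 0 < z.re ∧ z = (z.re : ℂ) := by
  obtain ⟨hre, him⟩ := Complex.pos_iff.mp hz
  exact ⟨hre, Complex.ext (Complex.ofReal_re _).symm (by rw [Complex.ofReal_im]; exact him.symm)⟩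

variable {ι : Type*} [LinearOrder ι] [Fintype ι]

/-- **`Γ` of a positive definite one-particle matrix is positive definite** (`Gamma` form of
`fockLift_posDef`: `M = yᴴy ⇒ Γ(M) = Γ(y)ᴴ Γ(y) ≥ 0`, and `Γ(M)` is a unit).  The fermionic half of
Lüscher's positivity of the Wilson transfer matrix. [cite: Luscher1977, §3] -/
theorem posDef_Gamma {M : Matrix ι ι ℂ} (hM : M.PosDef) : (Gamma M).PosDef := by
  rw [← FockLiftPosDef.fockLift_eq_Gamma']
  exact FockLiftPosDef.fockLift_posDef' hM

/-- **The positive square root of `r² • Γ(M)` is `r • Γ(M^{1/2})`**: if `r > 0` and `Rh` is a positive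
definite square root of `M` (`Rh² = M`) then `CFC.sqrt (r² • Γ(M)) = r • Γ(Rh)`, by uniqueness of the
non-negative square root (`CFC.sqrt_unique`): `(r • Γ(Rh))² = r² • Γ(Rh²) = r² • Γ(M)` (functoriality)
and `r • Γ(Rh) ≥ 0` (`posDef_Gamma`).  This is `T̂_F^{1/2} = det A · Γ(M_F^{1/2})` for Lüscher's
`T̂_F = (det A)² Γ(M_F)`. [cite: Smit2023, §6.5 (6.87)] -/
theorem cfcSqrt_sq_smul_Gamma {r : ℝ} (hr : 0 < r) {Rh M : Matrix ι ι ℂ} (hRh : Rh.PosDef)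
    (hsq : Rh * Rh = M) : CFC.sqrt (((r : ℂ)) ^ 2 • Gamma M) = (r : ℂ) • Gamma Rh := by
  have hr' : (0 : ℂ) < (r : ℂ) := by exact_mod_cast hr
  refine CFC.sqrt_unique ?_ ((posDef_Gamma hRh).smul hr').posSemidef.nonneg
  rw [smul_mul_smul_comm, ← Gamma_mul, hsq, pow_two]

/-- The inverse of `r • Γ(Rh)` for `r ≠ 0` and invertible `Rh` is `r⁻¹ • Γ(Rh⁻¹)`
(`Γ(Rh⁻¹) Γ(Rh) = Γ(1) = 1`). [folklore] -/
theorem inv_smul_Gamma {r : ℝ} (hr : r ≠ 0) {Rh : Matrix ι ι ℂ} (hRh : IsUnit Rh.det) :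
    ((r : ℂ) • Gamma Rh)⁻¹ = (r : ℂ)⁻¹ • Gamma Rh⁻¹ := by
  have hr' : (r : ℂ) ≠ 0 := by exact_mod_cast hr
  refine Matrix.inv_eq_left_inv ?_
  rw [smul_mul_smul_comm, Gamma_inv_mul hRh, inv_mul_cancel₀ hr', one_smul]

/-- **Conjugating `dΓ(Y)` by `r • Γ(Rh)` is a one-particle similarity**:
`(r • Γ(Rh))⁻¹ dΓ(Y) (r • Γ(Rh)) = dΓ(Rh⁻¹ Y Rh)` for `r ≠ 0` and invertible `Rh` — the scalar cancels
and `Γ(Rh⁻¹) dΓ(Y) Γ(Rh⁻¹⁻¹) = dΓ(Rh⁻¹ Y Rh⁻¹⁻¹)` is the covariance of `dΓ` under `Γ`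
(`StubGammaConjDGamma.Gamma_mul_dGamma_mul_Gamma_inv`, Dereziński–Gérard Prop. 3.23 (1)) at the unit
`Rh⁻¹`, with `Rh⁻¹⁻¹ = Rh`. [folklore] -/
theorem smul_Gamma_inv_mul_dGamma_mul {r : ℝ} (hr : r ≠ 0) {Rh : Matrix ι ι ℂ}
    (hRh : IsUnit Rh.det) (Y : Matrix ι ι ℂ) :
    ((r : ℂ) • Gamma Rh)⁻¹ * dGamma Y * ((r : ℂ) • Gamma Rh) = dGamma (Rh⁻¹ * Y * Rh) := by
  have hr' : (r : ℂ) ≠ 0 := by exact_mod_cast hr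
  have h := StubGammaConjDGamma.Gamma_mul_dGamma_mul_Gamma_inv
    ((Matrix.isUnit_nonsing_inv_det_iff (A := Rh)).mpr hRh) Y
  rw [Matrix.nonsing_inv_nonsing_inv _ hRh] at h
  rw [inv_smul_Gamma hr hRh, smul_mul_assoc, smul_mul_assoc, Matrix.mul_smul, smul_smul,
    inv_mul_cancel₀ hr', one_smul, h]

/-- Conjugating a constant by an invertible matrix does nothing: `X⁻¹ (c • 1) X = c • 1`.
[folklore] -/
theorem inv_mul_smul_one_mul {m : Type*} [Fintype m] [DecidableEq m] {X : Matrix m m ℂ}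
    (hX : IsUnit X.det) (c : ℂ) : X⁻¹ * (c • (1 : Matrix m m ℂ)) * X = c • 1 := by
  rw [Matrix.mul_smul, Matrix.mul_one, smul_mul_assoc, Matrix.nonsing_inv_mul _ hX]

/-- **Abstract form of the stub.**  For `r > 0`, a positive definite one-particle matrix `M` and
`T = r² • Γ(M)` (the shape of Lüscher's `T̂_F = (det A)² Γ(M_F)`): with `Rh := M^{1/2}` (positive
definite, `Rh² = M`) one has `T^{1/2} = r • Γ(Rh)` (uniqueness of the positive square root),
`T^{1/2}` is positive definite and squares to `T`, `T^{-1/2} dΓ(Y) T^{1/2} = dΓ(Rh⁻¹ Y Rh)` for every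
one-particle `Y`, and `T^{-1/2} (c • 1) T^{1/2} = c • 1`. [cite: Smit2023, §6.5 (6.87)] -/
theorem sqrt_sq_smul_Gamma_package {r : ℝ} (hr : 0 < r) {M : Matrix ι ι ℂ} (hM : M.PosDef)
    {T : Matrix (Finset ι) (Finset ι) ℂ} (hT : T = ((r : ℂ)) ^ 2 • Gamma M) :
    ∃ Rh : Matrix ι ι ℂ, Rh.PosDef ∧ Rh * Rh = M ∧ CFC.sqrt T = (r : ℂ) • Gamma Rh ∧
      (CFC.sqrt T).PosDef ∧ CFC.sqrt T * CFC.sqrt T = T ∧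
      (∀ Y : Matrix ι ι ℂ, (CFC.sqrt T)⁻¹ * dGamma Y * CFC.sqrt T = dGamma (Rh⁻¹ * Y * Rh)) ∧
      (∀ c : ℂ, (CFC.sqrt T)⁻¹ * (c • (1 : Matrix (Finset ι) (Finset ι) ℂ)) * CFC.sqrt T = c • 1) := by
  have hRh : (CFC.sqrt M).PosDef := (IsStrictlyPositive.sqrt _ hM.isStrictlyPositive).posDef
  have hsq : CFC.sqrt M * CFC.sqrt M = M := CFC.sqrt_mul_sqrt_self _ hM.posSemidef.nonneg
  have hTpos : T.PosDef := by
    rw [hT]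
    exact (posDef_Gamma hM).smul (pow_pos (by exact_mod_cast hr : (0 : ℂ) < (r : ℂ)) 2)
  have hR : (CFC.sqrt T).PosDef := (IsStrictlyPositive.sqrt _ hTpos.isStrictlyPositive).posDef
  have hsqrt : CFC.sqrt T = (r : ℂ) • Gamma (CFC.sqrt M) := by
    rw [hT]
    exact cfcSqrt_sq_smul_Gamma hr hRh hsq
  have hunit : IsUnit (CFC.sqrt M).det := (Matrix.isUnit_iff_isUnit_det _).mp hRh.isUnit
  refine ⟨CFC.sqrt M, hRh, hsq, hsqrt, hR, CFC.sqrt_mul_sqrt_self _ hTpos.posSemidef.nonneg,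
    fun Y => ?_, fun c => ?_⟩
  · rw [hsqrt]
    exact smul_Gamma_inv_mul_dGamma_mul hr.ne' hunit Y
  · exact inv_mul_smul_one_mul ((Matrix.isUnit_iff_isUnit_det _).mp hR.isUnit) c

end StubFermionSliceSqrtDGammaConj

/-- **E2 δ2c: the positive square root of `T̂_F(U)` is `det A(U) · Γ(M_F(U)^{1/2})`, and conjugating a
`dΓ`-insertion by it is a ONE-particle similarity** (registered stub signature verbatim).  For all bare
masses `m_f > −1` and every `SU(3)` background `U` on the spatial three-torus there are `r > 0` with
`det (sliceMassHop U mq) = r` (`A > 0`, `sliceMassHop_posDef`, `PosDef.det_pos`) and a positive definite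
`Rh` with `Rh² = reindex M_F(U)` (`fermionSliceMatrix_posDef`, `IsStrictlyPositive.sqrt`) such that
`T̂_F(U)^{1/2} = CFC.sqrt (fermionSliceOp U mq) = r • Γ(Rh)` (uniqueness of the non-negative square
root, `CFC.sqrt_unique`, since `T̂_F = (det A)² • Γ(M_F)` and `Γ` is multiplicative and positivity
preserving), `T̂_F^{1/2}` is positive definite and squares to `T̂_F`, and
`T̂_F^{-1/2} dΓ(Y) T̂_F^{1/2} = dΓ(Rh⁻¹ Y Rh)`, `T̂_F^{-1/2} (c • 1) T̂_F^{1/2} = c • 1`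
(covariance of `dΓ` under `Γ`, `stub_Gamma_conj_dGamma`).  Lüscher's transfer matrix for Wilson
fermions in Smit's symmetric form `T̂ = T̂_F^{1/2} T̂_U T̂_F^{1/2}`. [cite: Smit2023, §6.5 (6.87)] -/
theorem stub_fermionSlice_sqrt_dGamma_conj :
    ∀ (Nf S : ℕ) [NeZero S] (mq : Fin Nf → ℝ), (∀ f, -1 < mq f) →
      ∀ U : GaugeConfig 3 S (Matrix.specialUnitaryGroup (Fin 3) ℂ),
        ∃ (r : ℝ) (Rh : Matrix (SliceFermiIdx Nf S) (SliceFermiIdx Nf S) ℂ),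
          0 < r ∧ (sliceMassHop U mq).det = (r : ℂ) ∧ Rh.PosDef ∧
          Rh * Rh = Matrix.reindex sliceQuarkEquiv sliceQuarkEquiv (fermionSliceMatrix U mq) ∧
          CFC.sqrt (fermionSliceOp U mq) = (r : ℂ) • Gamma Rh ∧
          (CFC.sqrt (fermionSliceOp U mq)).PosDef ∧
          CFC.sqrt (fermionSliceOp U mq) * CFC.sqrt (fermionSliceOp U mq) = fermionSliceOp U mq ∧
          (∀ Y : Matrix (SliceFermiIdx Nf S) (SliceFermiIdx Nf S) ℂ,
            (CFC.sqrt (fermionSliceOp U mq))⁻¹ * dGamma Y * CFC.sqrt (fermionSliceOp U mq) = dGamma (Rh⁻¹ * Y * Rh)) ∧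
          (∀ c : ℂ, (CFC.sqrt (fermionSliceOp U mq))⁻¹ * (c • (1 : Matrix (Finset (SliceFermiIdx Nf S)) (Finset (SliceFermiIdx Nf S)) ℂ)) *
            CFC.sqrt (fermionSliceOp U mq) = c • 1) := by
  intro Nf S _ mq hm U
  have hA := sliceMassHop_posDef Nf S U mq hm
  have hM := fermionSliceMatrix_posDef Nf S U mq hm
  obtain ⟨hr, hdet⟩ := StubFermionSliceSqrtDGammaConj.eq_ofReal_re_of_pos hA.det_pos
  have hMF : (Matrix.reindex sliceQuarkEquiv sliceQuarkEquiv (fermionSliceMatrix U mq)).PosDef := by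
    rw [Matrix.reindex_apply]
    exact hM.submatrix sliceQuarkEquiv.symm.injective
  have hT : fermionSliceOp U mq = (((sliceMassHop U mq).det.re : ℂ)) ^ 2 •
      Gamma (Matrix.reindex sliceQuarkEquiv sliceQuarkEquiv (fermionSliceMatrix U mq)) := by
    rw [fermionSliceOp, FockLiftPosDef.fockLift_eq_Gamma', ← hdet]
  obtain ⟨Rh, hRh, hsq, hsqrt, hR, hRR, hY, hc⟩ :=
    StubFermionSliceSqrtDGammaConj.sqrt_sq_smul_Gamma_package hr hMF hT
  exact ⟨_, Rh, hr, hdet, hRh, hsq, hsqrt, hR, hRR, hY, hc⟩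

end Summit.QuantumFields.QCD.Cruxes.RobustYangMillsHandover.PinTheInfimum

end
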